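import Mathlib.RingTheory.Nullstellensatz
import Mathlib.RingTheory.Polynomial.UniqueFactorization
import Mathlib.Algebra.MvPolynomial.NoZeroDivisors
import Literature.Analysis.Complex.BranchedCoveringCharPolySCV
import HarnessLib

/-!
# A continuous function `u` with `Δ · u = P` for polynomials `Δ ≠ 0`, `P` is a polynomial

Layer `Literature/Analysis/Complex`. The last step of Serre's algebraisation argument (GAGA n° 20; SGA 1 XII 5.1):
once an (entire, here merely continuous) function `u : ℂ^m → ℂ` satisfies `Δ(w) u(w) = P(w)` for all `w` with
polynomials `Δ ≠ 0` and `P`, then `Δ` divides `P` and `u` is the polynomial `P/Δ`: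

* `dvd_of_eval_mul_eq` — `Δ ∣ P`: by induction over the irreducible factors `p` of `Δ` (`ℂ[w]` is a UFD); if
  `p ∤ P` then by Hilbert's Nullstellensatz (`(p)` is a radical ideal) there is a point with `p(w) = 0 ≠ P(w)`,
  contradicting `P(w) = Δ(w) u(w) = 0`; so `P = p P'`, and `Δ' u = P'` off `{p = 0}`, hence everywhere by density
  and continuity;
* `exists_mvPolynomial_eval_eq_of_eval_mul_eq` — hence `u = A` for a polynomial `A` with `Δ A = P`;
* `totalDegree_add_le_of_mul_eq` — and `deg Δ + deg A = deg P` when `A ≠ 0` (`ℂ[w]` is a domain), the degree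
  count used to bound the interpolating polynomial.

Everything is proved; no definitions, no named facts.

## References

* J.-P. Serre, *Géométrie algébrique et géométrie analytique*, Ann. Inst. Fourier 6 (1956), n° 20. [SerreGAGA1956]
-/

noncomputable section

open MvPolynomial Set Filter
open scoped Topology

namespace Literature.Analysis.Complex

namespace EntireQuotient

variable {m : ℕ}

/-- **An irreducible polynomial not dividing `P` has a zero where `P` does not vanish** (Nullstellensatz: the ideal
`(p)` of the prime `p` is radical, so `V(p) ⊆ V(P)` would force `p ∣ P`). [cite: SerreGAGA1956, n° 20] -/
theorem exists_eval_eq_zero_and_ne {p P : MvPolynomial (Fin m) ℂ} (hp : Irreducible p) (hpP : ¬ p ∣ P) :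
    ∃ w : Fin m → ℂ, eval w p = 0 ∧ eval w P ≠ 0 := by
  by_contra h
  push Not at h
  have hmem : P ∈ vanishingIdeal ℂ (zeroLocus ℂ (Ideal.span {p})) := by
    rw [mem_vanishingIdeal_iff]
    intro w hw
    have hpw : aeval w p = 0 := (mem_zeroLocus_iff.mp hw) p (Ideal.subset_span rfl)
    rw [aeval_eq_eval] at hpw ⊢
    exact h w hpw
  rw [vanishingIdeal_zeroLocus_eq_radical, (Ideal.span_singleton_prime hp.ne_zero).mpr hp.prime |>.radical,
    Ideal.mem_span_singleton] at hmem
  exact hpP hmem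

/-- **`Δ u = P` with `u` continuous forces `Δ ∣ P`.** [cite: SerreGAGA1956, n° 20] -/
theorem dvd_of_eval_mul_eq (Δ : MvPolynomial (Fin m) ℂ) (hΔ : Δ ≠ 0) :
    ∀ (P : MvPolynomial (Fin m) ℂ) (u : (Fin m → ℂ) → ℂ), Continuous u →
      (∀ w, eval w Δ * u w = eval w P) → Δ ∣ P := by
  induction Δ using WfDvdMonoid.induction_on_irreducible with
  | zero => exact absurd rfl hΔ
  | unit Δ hu => exact fun P _ _ _ ↦ hu.dvd
  | mul Δ' p hΔ'0 hp ih =>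
    intro P u hu heq
    -- `p ∣ P`
    have hpP : p ∣ P := by
      by_contra hnot
      obtain ⟨w, hpw, hPw⟩ := exists_eval_eq_zero_and_ne hp hnot
      have := heq w
      rw [map_mul, hpw, zero_mul, zero_mul] at this
      exact hPw this.symm
    obtain ⟨P', rfl⟩ := hpP
    -- `Δ' u = P'` off `{p = 0}`, hence everywhere
    have hp0 : p ≠ 0 := hp.ne_zero
    have heq' : ∀ w, eval w Δ' * u w = eval w P' := by
      have hdense : Dense {w : Fin m → ℂ | eval w p ≠ 0} := BranchedCoveringSCV.dense_setOf_eval_ne_zero hp0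
      have hclosed : IsClosed {w : Fin m → ℂ | eval w Δ' * u w = eval w P'} :=
        isClosed_eq (((BranchedCoveringSCV.differentiable_eval Δ').continuous).mul hu)
          (BranchedCoveringSCV.differentiable_eval P').continuous
      have hsub : {w : Fin m → ℂ | eval w p ≠ 0} ⊆ {w | eval w Δ' * u w = eval w P'} := by
        intro w hw
        have := heq w
        rw [map_mul, map_mul] at this
        exact mul_left_cancel₀ hw (by rw [← mul_assoc]; exact this)
      intro w
      have : w ∈ {w : Fin m → ℂ | eval w Δ' * u w = eval w P'} := by
        rw [← hclosed.closure_eq]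
        exact hdense.mono hsub |>.closure_eq ▸ mem_univ w
      exact this
    have hΔ' : Δ' ≠ 0 := fun h ↦ hΔ (by rw [h, mul_zero])
    exact mul_dvd_mul_left p (ih hΔ' P' u hu heq')

/-- **A continuous `u` with `Δ u = P` is a polynomial `A` with `Δ A = P`.** [cite: SerreGAGA1956, n° 20] -/
theorem exists_mvPolynomial_eval_eq_of_eval_mul_eq {Δ P : MvPolynomial (Fin m) ℂ} (hΔ : Δ ≠ 0)
    {u : (Fin m → ℂ) → ℂ} (hu : Continuous u) (heq : ∀ w, eval w Δ * u w = eval w P) :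
    ∃ A : MvPolynomial (Fin m) ℂ, Δ * A = P ∧ ∀ w, eval w A = u w := by
  obtain ⟨A, rfl⟩ := dvd_of_eval_mul_eq Δ hΔ P u hu heq
  refine ⟨A, rfl, ?_⟩
  have hdense : Dense {w : Fin m → ℂ | eval w Δ ≠ 0} := BranchedCoveringSCV.dense_setOf_eval_ne_zero hΔ
  have hclosed : IsClosed {w : Fin m → ℂ | eval w A = u w} :=
    isClosed_eq (BranchedCoveringSCV.differentiable_eval A).continuous hu
  have hsub : {w : Fin m → ℂ | eval w Δ ≠ 0} ⊆ {w | eval w A = u w} := by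
    intro w hw
    have := heq w
    rw [map_mul] at this
    exact (mul_left_cancel₀ hw this).symm
  intro w
  have : w ∈ {w : Fin m → ℂ | eval w A = u w} := by
    rw [← hclosed.closure_eq]
    exact hdense.mono hsub |>.closure_eq ▸ mem_univ w
  exact this

/-- **Degree count**: if `Δ A = P` with `A ≠ 0` (and `Δ ≠ 0`) then `deg Δ + deg A = deg P`.
[cite: SerreGAGA1956, n° 20] -/
theorem totalDegree_add_eq_of_mul_eq {Δ A P : MvPolynomial (Fin m) ℂ} (hΔ : Δ ≠ 0) (hA : A ≠ 0)
    (h : Δ * A = P) : Δ.totalDegree + A.totalDegree = P.totalDegree := by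
  rw [← h, totalDegree_mul_of_isDomain hΔ hA]

end EntireQuotient

end Literature.Analysis.Complex
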